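import Literature.Computability.Cryptography.FGProblemZoo
import Literature.Computability.Cryptography.WordRAMStructuredBlocks
import Mathlib.Data.Nat.Bits
import Mathlib.Data.Nat.Size
import HarnessLib

/-!
# A word-RAM transcoder from the word encoding of a CNF to a symbol-coded string encoding

Infrastructure for the machine-model bridge `kSATInRAMTime_of_kSATInExpTime`
(`Literature.Computability.FineGrained.SETHHardness`): a word-RAM `k`-SAT algorithm obtained from
a multi-stack Turing machine must first rewrite its input — the word list
`encodeCNFWords φ = numVars :: numClauses :: (|c| :: literals 2·var + polarity)_c` of
`Literature.Computability.Cryptography.FGProblemZoo` — into the machine's input string (Wave0's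
`KCNF.encode`: `numVars` in binary, a comma, and per clause a bracket, the literals as polarity
bit, binary digits of the variable, comma, and a closing bracket), each string symbol being
represented by a numeric code chosen by the simulation. This file provides that program and its
semantics, over the structured word-RAM layer `SProg` (`WordRAMStructured.lean`):

* `Codes` (the five symbol codes), `bitsCode`, `litCodes`, `clauseCodes`, `cnfCodes C φ` — the
  target code list, with binary digits least significant first (`Nat.bits`, which is
  `Computability.encodeNat`);
* `outMem G e₀ ys` — the data memory with the output `ys` written from address `e₀` on;
* the routines `emitC` (one code), `emitBits` (the binary digits of register `25`), `litLoop`,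
  `clauseLoop`, `transcode` with their semantics; **`transcode_exec`**: started on the relocated
  memory `SProg.relocated (encodeCNFWords φ)` (the state after the bootstrap `SProg.relocate`),
  `transcode C` writes `cnfCodes C φ` from address `2 L + 101` on (`L = |encodeCNFWords φ|`),
  leaving the end address in register `20` and the length in register `21`, within
  `transcodeTime φ = 14 + 9 · |bits numVars| + clauseTime φ` steps (`litTime`/`clauseTime`:
  `16 + 9 · |bits var|` per literal, `12` per clause), which is at most
  `14 + 9 B + 12 · numClauses + size · (16 + 9 B)` for any bound `B` on the binary lengths
  (`clauseTime_le`, `litTime_le`).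

[folklore] engineering; the encodings are those of Impagliazzo–Paturi, JCSS 62 (2001), §1
(formulas as clause lists) as fixed in `FGProblemZoo.lean` and `FineGrainedWave0.lean`.
-/

namespace Literature.Computability.FineGrained.KSatTranscoder

open Cryptography Cryptography.WordRAM Cryptography.WordRAM.SProg Complexity

/-! ## The target code list -/

/-- The numeric codes of the five string symbols used by the encoding: the two bits, the two
brackets and the comma. [folklore] -/
structure Codes where
  /-- code of the digit / polarity `0` -/
  b0 : ℕ
  /-- code of the digit / polarity `1` -/
  b1 : ℕ
  /-- code of the opening bracket -/
  bra : ℕ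
  /-- code of the closing bracket -/
  ket : ℕ
  /-- code of the comma -/
  comma : ℕ

namespace Codes

variable (C : Codes)

/-- The code of a bit. [folklore] -/
def bit (b : Bool) : ℕ := if b then C.b1 else C.b0

/-- The largest code. [folklore] -/
def sup : ℕ := max C.b0 (max C.b1 (max C.bra (max C.ket C.comma)))

/-- The binary digits of `v`, least significant first, as codes. [folklore] -/
def bitsCode (v : ℕ) : List ℕ := v.bits.map C.bit

/-- The codes of a literal `(i, b)`: polarity, digits of `i`, comma. [folklore] -/
def litCodes (l : ℕ × Bool) : List ℕ := C.bit l.2 :: C.bitsCode l.1 ++ [C.comma]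

/-- The codes of a clause: its literals between brackets. [folklore] -/
def clauseCodes (c : List (ℕ × Bool)) : List ℕ := C.bra :: c.flatMap C.litCodes ++ [C.ket]

/-- The codes of a CNF: digits of `numVars`, comma, clauses. [folklore] -/
def cnfCodes (φ : CNF ℕ) : List ℕ := C.bitsCode φ.numVars ++ C.comma :: φ.flatMap C.clauseCodes

/-- Every bit code is at most `sup`. [folklore] -/
theorem bit_le_sup (b : Bool) : C.bit b ≤ C.sup := by
  unfold bit sup; split_ifs <;> omega

/-- The bracket code is at most `sup`. [folklore] -/
theorem bra_le_sup : C.bra ≤ C.sup := by unfold sup; omega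

/-- The bracket code is at most `sup`. [folklore] -/
theorem ket_le_sup : C.ket ≤ C.sup := by unfold sup; omega

/-- The comma code is at most `sup`. [folklore] -/
theorem comma_le_sup : C.comma ≤ C.sup := by unfold sup; omega

/-- The bit codes are at most `sup`. [folklore] -/
theorem b0_le_sup : C.b0 ≤ C.sup := by unfold sup; omega

/-- The bit codes are at most `sup`. [folklore] -/
theorem b1_le_sup : C.b1 ≤ C.sup := by unfold sup; omega

end Codes

/-! ## Binary digits -/

/-- The digits of a nonzero number: the parity, then the digits of the half. [folklore] -/
theorem bits_of_ne_zero {v : ℕ} (hv : v ≠ 0) : v.bits = v.bodd :: (v / 2).bits := by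
  conv_lhs => rw [← Nat.bit_bodd_div2 v]
  rw [Nat.bits_append_bit _ _ fun h => ?_, Nat.div2_val]
  have := Nat.bit_bodd_div2 v
  rw [h] at this
  cases hb : v.bodd
  · rw [hb] at this; simp at this; exact absurd this.symm hv
  · rfl

/-- A number is zero iff it has no digits. [folklore] -/
theorem bits_eq_nil_iff {v : ℕ} : v.bits = [] ↔ v = 0 := by
  rw [← List.length_eq_zero_iff, Nat.size_eq_bits_len, Nat.size_eq_zero]

/-- The parity digit is `false` iff the number is even. [folklore] -/
theorem bodd_eq_false_iff {v : ℕ} : v.bodd = false ↔ v % 2 = 0 := by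
  rw [Nat.mod_two_of_bodd]; cases v.bodd <;> simp

/-- The number of digits of `v / 2 ^ j`-type quantities: digits of a number below `2 ^ B` are at most `B`. [folklore] -/
theorem length_bits_le {v B : ℕ} (h : v < 2 ^ B) : v.bits.length ≤ B := by
  rw [Nat.size_eq_bits_len]; exact Nat.size_le.2 h

/-! ## The output region -/

/-- The data memory with the code list `ys` written at `[e₀, e₀ + |ys|)`. [folklore] -/
def outMem (G : ℕ → ℕ) (e₀ : ℕ) (ys : List ℕ) : ℕ → ℕ := fun a =>
  if e₀ ≤ a ∧ a < e₀ + ys.length then ys.getD (a - e₀) 0 else G a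

/-- Nothing written yet. [folklore] -/
@[simp] theorem outMem_nil (G : ℕ → ℕ) (e₀ : ℕ) : outMem G e₀ [] = G := by
  funext a; simp [outMem]

/-- Below the output region the memory is untouched. [folklore] -/
theorem outMem_of_lt (G : ℕ → ℕ) {e₀ : ℕ} (ys : List ℕ) {a : ℕ} (ha : a < e₀) :
    outMem G e₀ ys a = G a := by
  unfold outMem; rw [if_neg (by omega)]

/-- Inside the output region the memory holds the output. [folklore] -/
theorem outMem_add (G : ℕ → ℕ) (e₀ : ℕ) (ys : List ℕ) {t : ℕ} (ht : t < ys.length) :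
    outMem G e₀ ys (e₀ + t) = ys[t] := by
  unfold outMem
  rw [if_pos ⟨by omega, by omega⟩, Nat.add_sub_cancel_left, List.getD_eq_getElem _ _ ht]

/-- Past the output region the memory is untouched. [folklore] -/
theorem outMem_of_le (G : ℕ → ℕ) {e₀ : ℕ} (ys : List ℕ) {a : ℕ} (ha : e₀ + ys.length ≤ a) :
    outMem G e₀ ys a = G a := by
  unfold outMem; rw [if_neg (by omega)]

/-- Emitting one more code. [folklore] -/
theorem outMem_snoc (G : ℕ → ℕ) (e₀ : ℕ) (ys : List ℕ) (c : ℕ) :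
    Function.update (outMem G e₀ ys) (e₀ + ys.length) c = outMem G e₀ (ys ++ [c]) := by
  funext a
  by_cases ha : a = e₀ + ys.length
  · subst ha
    rw [Function.update_self, outMem_add G e₀ (ys ++ [c]) (by simp)]
    simp
  · rw [Function.update_of_ne ha]
    unfold outMem
    simp only [List.length_append, List.length_singleton]
    by_cases h1 : e₀ ≤ a ∧ a < e₀ + ys.length
    · rw [if_pos h1, if_pos ⟨h1.1, by omega⟩, List.getD_append _ _ _ _ (by omega)]
    · rw [if_neg h1, if_neg (by omega)]

/-! ## The routines -/

/-- Emit the code `c`: `mem[r20] := c; r20 += 1; r21 += 1`. [folklore] -/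
def emitC (c : ℕ) : List OpSpec :=
  [(.add, .ind 20, .imm c, .imm 0), (.add, .dir 20, .dir 20, .imm 1), (.add, .dir 21, .dir 21, .imm 1)]

/-- Emit the binary digits of register `25`, least significant first (destroying it):
`while r25 ≠ 0 { r26 := r25 % 2; if r26 = 0 then emit b0 else emit b1; r25 /= 2 }`. [folklore] -/
def emitBits (C : Codes) : SProg :=
  whilenz (.dir 25) (seq (block [(.mod, .dir 26, .dir 25, .imm 2)])
    (seq (ifz (.dir 26) (block (emitC C.b0)) (block (emitC C.b1)))
      (block [(.div, .dir 25, .dir 25, .imm 2)])))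

/-- The literal loop: `r24` literals are read from the pointer `r22` on; each word
`u = 2 i + b` is emitted as polarity bit `b`, digits of `i`, comma. [folklore] -/
def litLoop (C : Codes) : SProg :=
  whilenz (.dir 24) (seq (block [(.add, .dir 26, .ind 22, .imm 0), (.add, .dir 22, .dir 22, .imm 1),
      (.div, .dir 25, .dir 26, .imm 2), (.mod, .dir 26, .dir 26, .imm 2)])
    (seq (ifz (.dir 26) (block (emitC C.b0)) (block (emitC C.b1)))
      (seq (emitBits C) (seq (block (emitC C.comma)) (block [(.sub, .dir 24, .dir 24, .imm 1)])))))

/-- The clause loop: `r23` clauses, each read as its length followed by its literal words, are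
emitted between brackets. [folklore] -/
def clauseLoop (C : Codes) : SProg :=
  whilenz (.dir 23) (seq (block (emitC C.bra))
    (seq (block [(.add, .dir 24, .ind 22, .imm 0), (.add, .dir 22, .dir 22, .imm 1)])
      (seq (litLoop C) (seq (block (emitC C.ket)) (block [(.sub, .dir 23, .dir 23, .imm 1)])))))

/-- **The transcoder**, to be run after the bootstrap `SProg.relocate` (cell `1` = `D = L + 100`,
the input words at `D + 1, …, D + L`): set the output pointer `r20 := 2 D - 99 = 2 L + 101`, the
count `r21 := 0` and the read pointer `r22 := D + 1`; emit the digits of `numVars` and a comma;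
read `numClauses` into `r23`; run the clause loop. [folklore] -/
def transcode (C : Codes) : SProg :=
  seq (block [(.add, .dir 20, .dir 1, .dir 1), (.sub, .dir 20, .dir 20, .imm 99),
      (.add, .dir 21, .imm 0, .imm 0), (.add, .dir 22, .dir 1, .imm 1), (.add, .dir 25, .ind 22, .imm 0),
      (.add, .dir 22, .dir 22, .imm 1)])
    (seq (emitBits C) (seq (block (emitC C.comma))
      (seq (block [(.add, .dir 23, .ind 22, .imm 0), (.add, .dir 22, .dir 22, .imm 1)]) (clauseLoop C))))

/-- `transcode` makes no oracle query. [folklore] -/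
theorem transcode_queryFree (C : Codes) : (transcode C).QueryFree := by
  simp [transcode, clauseLoop, litLoop, emitBits, QueryFree, block_queryFree]

/-- The word of a literal in `encodeCNFWords`: `2 · var + polarity`. [folklore] -/
def litWord (l : ℕ × Bool) : ℕ := 2 * l.1 + l.2.toNat

/-- The words of a clause list in `encodeCNFWords`: per clause its length, then its literal words. [folklore] -/
def clauseWords (cs : List (List (ℕ × Bool))) : List ℕ :=
  cs.flatMap fun c => c.length :: c.map litWord

/-- `encodeCNFWords` is `numVars`, `numClauses`, then the clause words. [folklore] -/
theorem encodeCNFWords_eq (φ : CNF ℕ) :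
    encodeCNFWords φ = φ.numVars :: φ.numClauses :: clauseWords φ := rfl

/-- Unfolding `clauseWords` on a cons. [folklore] -/
theorem clauseWords_cons (c : List (ℕ × Bool)) (cs : List (List (ℕ × Bool))) :
    clauseWords (c :: cs) = c.length :: c.map litWord ++ clauseWords cs := by
  simp [clauseWords]

/-- Every clause contributes at least its length word. [folklore] -/
theorem length_le_length_clauseWords : ∀ cs : List (List (ℕ × Bool)),
    cs.length ≤ (clauseWords cs).length
  | [] => by simp [clauseWords]
  | c :: cs => by
    rw [clauseWords_cons, List.length_cons, List.length_append, List.length_cons]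
    have := length_le_length_clauseWords cs
    omega

/-- Parity and half of a literal word. [folklore] -/
theorem litWord_mod_div (l : ℕ × Bool) : litWord l % 2 = l.2.toNat ∧ litWord l / 2 = l.1 := by
  unfold litWord; cases l.2 <;> simp; omega

/-- A bound on the time of the literal loop: `16 + 9 · (binary length)` per literal. [folklore] -/
def litTime : List (ℕ × Bool) → ℕ
  | [] => 0
  | l :: ls => 16 + 9 * l.1.bits.length + litTime ls

/-- A bound on the time of the clause loop: `12` per clause plus its literal loop. [folklore] -/
def clauseTime : List (List (ℕ × Bool)) → ℕ
  | [] => 0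
  | c :: cs => 12 + litTime c + clauseTime cs

/-- A bound on the time of the transcoder. [folklore] -/
def transcodeTime (φ : CNF ℕ) : ℕ := 14 + 9 * φ.numVars.bits.length + clauseTime φ

/-- `litTime` under a uniform bound on binary lengths. [folklore] -/
theorem litTime_le {B : ℕ} : ∀ {ls : List (ℕ × Bool)}, (∀ l ∈ ls, l.1.bits.length ≤ B) →
    litTime ls ≤ ls.length * (16 + 9 * B)
  | [], _ => by simp [litTime]
  | l :: ls, h => by
    have h1 := h l (by simp)
    have h2 := litTime_le (ls := ls) fun l' hl' => h l' (by simp [hl'])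
    simp only [litTime, List.length_cons]
    have := Nat.mul_le_mul_left 9 h1
    rw [Nat.add_mul, Nat.one_mul]; omega

/-- `clauseTime` under a uniform bound on binary lengths: `12` per clause, `16 + 9 B` per literal. [folklore] -/
theorem clauseTime_le {B : ℕ} : ∀ {cs : List (List (ℕ × Bool))},
    (∀ c ∈ cs, ∀ l ∈ c, l.1.bits.length ≤ B) →
    clauseTime cs ≤ cs.length * 12 + (cs.map List.length).sum * (16 + 9 * B)
  | [], _ => by simp [clauseTime]
  | c :: cs, h => by
    have h1 := litTime_le (h c (by simp))
    have h2 := clauseTime_le (cs := cs) fun c' hc' => h c' (by simp [hc'])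
    simp only [clauseTime, List.length_cons, List.map_cons, List.sum_cons]
    rw [Nat.add_mul, Nat.one_mul, Nat.add_mul]; omega

/-! ## Semantics of the routines -/

section exec

variable {w : ℕ} {O : List ℕ → List ℕ}

/-- Emitting one code. [folklore] -/
theorem emitC_exec {R G : ℕ → ℕ} {e₀ : ℕ} {ys : List ℕ} {c : ℕ} (h20 : R 20 = e₀ + ys.length)
    (h21 : R 21 = ys.length) (he : 100 ≤ e₀) (hc : c < 2 ^ w) (hw : e₀ + ys.length + 1 < 2 ^ w)
    (qs : List (List ℕ)) :
    Exec w O (block (emitC c)) ⟨merge R (outMem G e₀ ys), qs⟩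
      ⟨merge (Function.update (Function.update R 20 (e₀ + ys.length + 1)) 21 (ys.length + 1))
        (outMem G e₀ (ys ++ [c])), qs⟩ 3 := by
  have key : ∀ Rf, execOps w (merge R (outMem G e₀ ys)) (emitC c) = Rf →
      Rf = merge (Function.update (Function.update R 20 (e₀ + ys.length + 1)) 21 (ys.length + 1))
        (Function.update (outMem G e₀ ys) (e₀ + ys.length) c) := by
    intro Rf hR
    unfold emitC at hR
    have htmp := execOps_cons_fwd hR; clear hR; obtain ⟨v1, hv1, hR⟩ := htmp
    simp -failIfUnchanged (disch := omega) only [Operand.write, Operand.read, merge_apply_of_lt,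

      update_merge_of_le, Nat.add_zero, BinOp.eval_add_of_lt, h20]
      at hv1 hR
    have htmp := execOps_cons_fwd hR; clear hR; obtain ⟨v2, hv2, hR⟩ := htmp
    simp -failIfUnchanged (disch := omega) only [Operand.write, Operand.read, merge_apply_of_lt,
      update_merge_of_lt,
      BinOp.eval_add_of_lt, h20,
      ← hv1] at hv2 hR
    have htmp := execOps_cons_fwd hR; clear hR; obtain ⟨v3, hv3, hR⟩ := htmp
    simp -failIfUnchanged (disch := omega) only [Operand.write, Operand.read, merge_apply_of_lt,
      Function.update_of_ne, update_merge_of_lt,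
      BinOp.eval_add_of_lt, h21,
      ← hv2] at hv3 hR
    simp only [execOps_nil] at hR; subst hR
    subst hv1 hv2 hv3
    rfl
  have hfin := key _ rfl
  rw [outMem_snoc] at hfin
  exact Exec.block' _ qs hfin

/-- Emitting one of the two bit codes according to register `26`. [folklore] -/
theorem emitBit_exec (C : Codes) (hC : C.sup < 2 ^ w) {R G : ℕ → ℕ} {e₀ : ℕ} {ys : List ℕ}
    {b : Bool} (h20 : R 20 = e₀ + ys.length) (h21 : R 21 = ys.length) (h26 : R 26 = b.toNat)
    (he : 100 ≤ e₀) (hw : e₀ + ys.length + 1 < 2 ^ w) (qs : List (List ℕ)) :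
    ∃ t, t ≤ 5 ∧ Exec w O (ifz (.dir 26) (block (emitC C.b0)) (block (emitC C.b1)))
      ⟨merge R (outMem G e₀ ys), qs⟩
      ⟨merge (Function.update (Function.update R 20 (e₀ + ys.length + 1)) 21 (ys.length + 1))
        (outMem G e₀ (ys ++ [C.bit b])), qs⟩ t := by
  have h0 := C.b0_le_sup
  have h1 := C.b1_le_sup
  cases b with
  | false =>
    refine ⟨3 + 1, by omega, Exec.ifz_zero ?_ ?_⟩
    · simp [Operand.read_dir_merge (show 26 < 100 by decide), h26]
    · simpa [Codes.bit] using emitC_exec (O := O) (G := G) (c := C.b0) h20 h21 he (by omega) hw qs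
  | true =>
    refine ⟨3 + 2, by omega, Exec.ifz_ne ?_ ?_⟩
    · simp [Operand.read_dir_merge (show 26 < 100 by decide), h26]
    · simpa [Codes.bit] using emitC_exec (O := O) (G := G) (c := C.b1) h20 h21 he (by omega) hw qs

/-- **Semantics of `emitBits`**: the binary digits of register `25` are appended to the output,
within `9 · (number of digits) + 1` steps. [folklore] -/
theorem emitBits_exec (C : Codes) (hC : C.sup < 2 ^ w) {G : ℕ → ℕ} {e₀ : ℕ} (he : 100 ≤ e₀)
    (qs : List (List ℕ)) :
    ∀ (n v : ℕ), v.bits.length = n → v < 2 ^ w → ∀ (ys : List ℕ) (R : ℕ → ℕ),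
      R 20 = e₀ + ys.length → R 21 = ys.length → R 25 = v →
      e₀ + (ys ++ C.bitsCode v).length < 2 ^ w →
      ∃ (R' : ℕ → ℕ) (t : ℕ), Exec w O (emitBits C) ⟨merge R (outMem G e₀ ys), qs⟩
          ⟨merge R' (outMem G e₀ (ys ++ C.bitsCode v)), qs⟩ t ∧
        t ≤ 9 * n + 1 ∧ R' 20 = e₀ + (ys ++ C.bitsCode v).length ∧
        R' 21 = (ys ++ C.bitsCode v).length ∧ R' 25 = 0 ∧
        ∀ a, a ≠ 20 → a ≠ 21 → a ≠ 25 → a ≠ 26 → R' a = R a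
  | 0, v, hn, hv, ys, R, h20, h21, h25, hw => by
    have hv0 : v = 0 := bits_eq_nil_iff.1 (List.length_eq_zero_iff.1 hn)
    subst hv0
    have hnil : C.bitsCode 0 = [] := by simp [Codes.bitsCode, Nat.zero_bits]
    rw [hnil, List.append_nil]
    refine ⟨R, 1, Exec.while_zero ?_, le_rfl, h20, h21, h25, fun a _ _ _ _ => rfl⟩
    simp [Operand.read_dir_merge (show 25 < 100 by decide), h25]
  | n + 1, v, hn, hv, ys, R, h20, h21, h25, hw => by
    have hv0 : v ≠ 0 := fun h => by subst h; simp [Nat.zero_bits] at hn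
    have hbits : v.bits = v.bodd :: (v / 2).bits := bits_of_ne_zero hv0
    have hcode : C.bitsCode v = C.bit v.bodd :: C.bitsCode (v / 2) := by
      simp [Codes.bitsCode, hbits]
    have hn' : (v / 2).bits.length = n := by
      rw [hbits, List.length_cons] at hn; omega
    -- r26 := v % 2
    have hA : Exec w O (block [(.mod, .dir 26, .dir 25, .imm 2)]) ⟨merge R (outMem G e₀ ys), qs⟩
        ⟨merge (Function.update R 26 (v % 2)) (outMem G e₀ ys), qs⟩ 1 :=
      Exec.block' _ qs (by
        simp [execOps, execOp, Operand.write, Operand.read, merge_apply_of_lt, update_merge_of_lt,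
          h25])
    -- the bit
    have h26 : Function.update R 26 (v % 2) 26 = (v.bodd).toNat := by
      simp [Nat.mod_two_of_bodd]
    have hw1 : e₀ + ys.length + 1 < 2 ^ w := by
      rw [hcode] at hw; simp at hw; omega
    obtain ⟨tB, htB, hB⟩ := emitBit_exec C hC (G := G) (b := v.bodd) (by simp [h20]) (by simp [h21])
      h26 he hw1 qs
    -- r25 := v / 2
    set R₂ : ℕ → ℕ := Function.update (Function.update (Function.update R 26 (v % 2)) 20
      (e₀ + ys.length + 1)) 21 (ys.length + 1) with hR₂
    have hCx : Exec w O (block [(.div, .dir 25, .dir 25, .imm 2)])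
        ⟨merge R₂ (outMem G e₀ (ys ++ [C.bit v.bodd])), qs⟩
        ⟨merge (Function.update R₂ 25 (v / 2)) (outMem G e₀ (ys ++ [C.bit v.bodd])), qs⟩ 1 :=
      Exec.block' _ qs (by
        simp [execOps, execOp, Operand.write, Operand.read, merge_apply_of_lt, update_merge_of_lt,
          hR₂, h25])
    -- the remaining digits
    have hw' : e₀ + (ys ++ [C.bit v.bodd] ++ C.bitsCode (v / 2)).length < 2 ^ w := by
      rw [hcode] at hw; simpa using hw
    obtain ⟨R', t', hrec, ht', h20', h21', h25', hR'⟩ := emitBits_exec C hC he qs n (v / 2) hn'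
      (by omega) (ys ++ [C.bit v.bodd]) (Function.update R₂ 25 (v / 2)) (by simp [hR₂, Nat.add_assoc])
      (by simp [hR₂]) (by simp) hw'
    have heq : ys ++ [C.bit v.bodd] ++ C.bitsCode (v / 2) = ys ++ C.bitsCode v := by
      rw [hcode, List.append_assoc, List.singleton_append]
    rw [heq] at hrec h20' h21'
    refine ⟨R', 1 + (tB + 1) + t' + 2, Exec.while_ne ?_ (hA.seq (hB.seq hCx)) hrec, by omega,
      h20', h21', h25', fun a ha hb hc hd => ?_⟩
    · simp [Operand.read_dir_merge (show 25 < 100 by decide), h25, hv0]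
    · rw [hR' a ha hb hc hd]; simp [hR₂, ha, hb, hc, hd]

/-- The four reading instructions of the literal loop: `r26 := mem[r22]; r22 += 1; r25 := r26 / 2;
r26 := r26 % 2`. [folklore] -/
theorem litRead_exec {R H : ℕ → ℕ} {p u : ℕ} (h22 : R 22 = p) (hp : 100 ≤ p) (hu : H p = u)
    (huw : u < 2 ^ w) (hpw : p + 1 < 2 ^ w) (qs : List (List ℕ)) :
    Exec w O (block [(.add, .dir 26, .ind 22, .imm 0), (.add, .dir 22, .dir 22, .imm 1),
      (.div, .dir 25, .dir 26, .imm 2), (.mod, .dir 26, .dir 26, .imm 2)]) ⟨merge R H, qs⟩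
      ⟨merge (Function.update (Function.update (Function.update (Function.update R 26 u) 22 (p + 1))
        25 (u / 2)) 26 (u % 2)) H, qs⟩ 4 := by
  have key : ∀ Rf, execOps w (merge R H) [(.add, .dir 26, .ind 22, .imm 0),
      (.add, .dir 22, .dir 22, .imm 1), (.div, .dir 25, .dir 26, .imm 2), (.mod, .dir 26, .dir 26, .imm 2)]
      = Rf → Rf = merge (Function.update (Function.update (Function.update (Function.update R 26 u)
        22 (p + 1)) 25 (u / 2)) 26 (u % 2)) H := by
    intro Rf hR
    have htmp := execOps_cons_fwd hR; clear hR; obtain ⟨v1, hv1, hR⟩ := htmp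
    simp -failIfUnchanged (disch := omega) only [Operand.write, Operand.read, merge_apply_of_lt,
      merge_apply_of_le, update_merge_of_lt,
      Nat.add_zero, BinOp.eval_add_of_lt,
      h22, hu] at hv1 hR
    have htmp := execOps_cons_fwd hR; clear hR; obtain ⟨v2, hv2, hR⟩ := htmp
    simp -failIfUnchanged (disch := omega) only [Operand.write, Operand.read, merge_apply_of_lt,
      Function.update_of_ne, update_merge_of_lt,
      BinOp.eval_add_of_lt,
      h22, ← hv1] at hv2 hR
    have htmp := execOps_cons_fwd hR; clear hR; obtain ⟨v3, hv3, hR⟩ := htmp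
    simp -failIfUnchanged (disch := omega) only [Operand.write, Operand.read, merge_apply_of_lt,
      Function.update_self, Function.update_of_ne, update_merge_of_lt,
      BinOp.eval_div,
      ← hv2] at hv3 hR
    have htmp := execOps_cons_fwd hR; clear hR; obtain ⟨v4, hv4, hR⟩ := htmp
    simp -failIfUnchanged (disch := omega) only [Operand.write, Operand.read, merge_apply_of_lt,
      Function.update_self, Function.update_of_ne, update_merge_of_lt,

      BinOp.eval_mod, ← hv3] at hv4 hR
    simp only [execOps_nil] at hR; subst hR
    subst hv1 hv2 hv3 hv4
    rfl
  exact Exec.block' _ qs (key _ rfl)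

/-- Two instructions reading a count: `r := mem[r22]; r22 += 1` for `r = 23` or `24`. [folklore] -/
theorem cntRead_exec {R H : ℕ → ℕ} {p u r : ℕ} (hr : r = 23 ∨ r = 24) (h22 : R 22 = p)
    (hp : 100 ≤ p) (hu : H p = u) (huw : u < 2 ^ w) (hpw : p + 1 < 2 ^ w) (qs : List (List ℕ)) :
    Exec w O (block [(.add, .dir r, .ind 22, .imm 0), (.add, .dir 22, .dir 22, .imm 1)]) ⟨merge R H, qs⟩
      ⟨merge (Function.update (Function.update R r u) 22 (p + 1)) H, qs⟩ 2 := by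
  have hr100 : r < 100 := by omega
  have hr22 : (22 : ℕ) ≠ r := by omega
  have key : ∀ Rf, execOps w (merge R H) [(.add, .dir r, .ind 22, .imm 0),
      (.add, .dir 22, .dir 22, .imm 1)] = Rf →
      Rf = merge (Function.update (Function.update R r u) 22 (p + 1)) H := by
    intro Rf hR
    have htmp := execOps_cons_fwd hR; clear hR; obtain ⟨v1, hv1, hR⟩ := htmp
    simp -failIfUnchanged (disch := omega) only [Operand.write, Operand.read, merge_apply_of_lt,
      merge_apply_of_le, update_merge_of_lt,
      Nat.add_zero, BinOp.eval_add_of_lt,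
      h22, hu] at hv1 hR
    have htmp := execOps_cons_fwd hR; clear hR; obtain ⟨v2, hv2, hR⟩ := htmp
    simp -failIfUnchanged (disch := omega) only [Operand.write, Operand.read, merge_apply_of_lt,
      Function.update_of_ne, update_merge_of_lt,
      BinOp.eval_add_of_lt,
      h22, ← hv1] at hv2 hR
    simp only [execOps_nil] at hR; subst hR
    subst hv1 hv2
    rfl
  exact Exec.block' _ qs (key _ rfl)

/-- Decrementing a positive counter register `r = 23` or `24`. [folklore] -/
theorem dec_exec {R H : ℕ → ℕ} {r m : ℕ} (hr : r = 23 ∨ r = 24) (hm : R r = m + 1)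
    (hmw : m + 1 < 2 ^ w) (qs : List (List ℕ)) :
    Exec w O (block [(.sub, .dir r, .dir r, .imm 1)]) ⟨merge R H, qs⟩
      ⟨merge (Function.update R r m) H, qs⟩ 1 := by
  have hr100 : r < 100 := by omega
  refine Exec.block' _ qs ?_
  simp only [execOps_cons, execOps_nil, execOp, Operand.read, Operand.write,
    merge_apply_of_lt hr100, hm, update_merge_of_lt _ _ hr100]
  rw [BinOp.eval_sub_of_le (by omega) hmw, Nat.add_sub_cancel]

/-- **Semantics of the literal loop**: the `r24` literals whose words are stored from address
`r22` on are appended to the output as their codes, within `litTime + 1` steps; the read pointer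
ends past them, register `23` is kept. [folklore] -/
theorem litLoop_exec (C : Codes) (hC : C.sup < 2 ^ w) {G : ℕ → ℕ} {e₀ : ℕ} (he : 100 ≤ e₀)
    (qs : List (List ℕ)) :
    ∀ (ls : List (ℕ × Bool)) (ys : List ℕ) (R : ℕ → ℕ) (p : ℕ),
      R 20 = e₀ + ys.length → R 21 = ys.length → R 22 = p → R 24 = ls.length → 100 ≤ p →
      p + ls.length ≤ e₀ → (∀ t, t < ls.length → G (p + t) = (ls.map litWord).getD t 0) →
      (∀ l ∈ ls, litWord l < 2 ^ w) → e₀ + (ys ++ ls.flatMap C.litCodes).length < 2 ^ w →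
      ∃ (R' : ℕ → ℕ) (t : ℕ), Exec w O (litLoop C) ⟨merge R (outMem G e₀ ys), qs⟩
          ⟨merge R' (outMem G e₀ (ys ++ ls.flatMap C.litCodes)), qs⟩ t ∧
        t ≤ litTime ls + 1 ∧ R' 20 = e₀ + (ys ++ ls.flatMap C.litCodes).length ∧
        R' 21 = (ys ++ ls.flatMap C.litCodes).length ∧ R' 22 = p + ls.length ∧ R' 23 = R 23
  | [], ys, R, p, h20, h21, h22, h24, hp, hpe, hG, hlw, hw => by
    refine ⟨R, 1, ?_, by simp [litTime], by simpa using h20, by simpa using h21, by simpa using h22,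
      rfl⟩
    rw [List.flatMap_nil, List.append_nil]
    exact Exec.while_zero (by simp [Operand.read_dir_merge (show 24 < 100 by decide), h24])
  | l :: ls, ys, R, p, h20, h21, h22, h24, hp, hpe, hG, hlw, hw => by
    have hl0 : G p = litWord l := by simpa using hG 0 (by simp)
    have hGp : outMem G e₀ ys p = litWord l := by
      rw [outMem_of_lt G ys (show p < e₀ by simp at hpe; omega), hl0]
    have hltot : (ys ++ (l :: ls).flatMap C.litCodes).length =
        ys.length + (l.1.bits.length + 2) + (ls.flatMap C.litCodes).length := by
      simp [Codes.litCodes, Codes.bitsCode]; omega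
    rw [hltot] at hw
    -- 1. read the word
    have h1 := litRead_exec (w := w) (O := O) (H := outMem G e₀ ys) h22 hp hGp (hlw l (by simp))
      (by simp at hpe; omega) qs
    rw [(litWord_mod_div l).1, (litWord_mod_div l).2] at h1
    set R₁ : ℕ → ℕ := Function.update (Function.update (Function.update (Function.update R 26
      (litWord l)) 22 (p + 1)) 25 l.1) 26 l.2.toNat with hR₁
    -- 2. the polarity bit
    obtain ⟨tB, htB, h2⟩ := emitBit_exec C hC (G := G) (R := R₁) (ys := ys) (b := l.2)
      (by simp [hR₁, h20]) (by simp [hR₁, h21]) (by simp [hR₁]) he (by omega) qs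
    set R₂ : ℕ → ℕ := Function.update (Function.update R₁ 20 (e₀ + ys.length + 1)) 21
      (ys.length + 1) with hR₂
    -- 3. the digits of the variable
    obtain ⟨R₃, t3, h3, ht3, h20₃, h21₃, -, hR₃⟩ := emitBits_exec C hC (G := G) he qs _ l.1 rfl
      (by have := hlw l (by simp); unfold litWord at this; omega) (ys ++ [C.bit l.2]) R₂
      (by simp [hR₂, Nat.add_assoc]) (by simp [hR₂]) (by simp [hR₂, hR₁])
      (by simp [Codes.bitsCode]; omega)
    -- 4. the comma
    have h4 := emitC_exec (O := O) (G := G) (c := C.comma) h20₃ h21₃ he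
      (lt_of_le_of_lt C.comma_le_sup hC) (by simp [Codes.bitsCode]; omega) qs
    -- 5. the counter
    have h24₃ : (Function.update (Function.update R₃ 20
        (e₀ + (ys ++ [C.bit l.2] ++ C.bitsCode l.1).length + 1)) 21
        ((ys ++ [C.bit l.2] ++ C.bitsCode l.1).length + 1)) 24 = ls.length + 1 := by
      simp [hR₃ 24 (by decide) (by decide) (by decide) (by decide), hR₂, hR₁, h24]
    have h5 := dec_exec (w := w) (O := O)
      (H := outMem G e₀ (ys ++ [C.bit l.2] ++ C.bitsCode l.1 ++ [C.comma])) (Or.inr rfl) h24₃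
      (by simp at hpe; omega) qs
    -- 6. the remaining literals
    have heq : ys ++ [C.bit l.2] ++ C.bitsCode l.1 ++ [C.comma] = ys ++ C.litCodes l := by
      simp [Codes.litCodes]
    rw [heq] at h4 h5
    set R₄ : ℕ → ℕ := Function.update (Function.update (Function.update R₃ 20
      (e₀ + (ys ++ [C.bit l.2] ++ C.bitsCode l.1).length + 1)) 21
      ((ys ++ [C.bit l.2] ++ C.bitsCode l.1).length + 1)) 24 ls.length with hR₄
    have hlenl : (ys ++ C.litCodes l).length = (ys ++ [C.bit l.2] ++ C.bitsCode l.1).length + 1 := by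
      simp [Codes.litCodes]; omega
    obtain ⟨R', t', hrec, ht', h20', h21', h22', h23'⟩ := litLoop_exec C hC he qs ls
      (ys ++ C.litCodes l) R₄ (p + 1) (by rw [hlenl]; simp [hR₄]; omega)
      (by rw [hlenl]; simp [hR₄])
      (by simp [hR₄, hR₃ 22 (by decide) (by decide) (by decide) (by decide), hR₂, hR₁])
      (by simp [hR₄]) (by omega) (by simp at hpe ⊢; omega)
      (fun t ht => by
        have := hG (t + 1) (by simp; omega)
        simpa [Nat.add_assoc, Nat.add_comm 1 t] using this)
      (fun l' hl' => hlw l' (by simp [hl'])) (by simp [Codes.litCodes, Codes.bitsCode] at hw ⊢; omega)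
    rw [List.append_assoc] at hrec h20' h21'
    have hfl : C.litCodes l ++ ls.flatMap C.litCodes = (l :: ls).flatMap C.litCodes := by simp
    rw [hfl] at hrec h20' h21'
    refine ⟨R', (4 + (tB + (t3 + (3 + 1)))) + t' + 2,
      Exec.while_ne ?_ (h1.seq (h2.seq (h3.seq (h4.seq h5)))) hrec, ?_, h20', h21',
      by rw [h22']; simp; omega, ?_⟩
    · simp [Operand.read_dir_merge (show 24 < 100 by decide), h24]
    · simp only [litTime]; omega
    · rw [h23']
      simp [hR₄, hR₃ 23 (by decide) (by decide) (by decide) (by decide), hR₂, hR₁]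

/-- **Semantics of the clause loop**: the `r23` clauses whose words (`clauseWords`) are stored from
address `r22` on are appended to the output as their codes, within `clauseTime + 1` steps. [folklore] -/
theorem clauseLoop_exec (C : Codes) (hC : C.sup < 2 ^ w) {G : ℕ → ℕ} {e₀ : ℕ} (he : 100 ≤ e₀)
    (qs : List (List ℕ)) :
    ∀ (cs : List (List (ℕ × Bool))) (ys : List ℕ) (R : ℕ → ℕ) (p : ℕ),
      R 20 = e₀ + ys.length → R 21 = ys.length → R 22 = p → R 23 = cs.length → 100 ≤ p →
      p + (clauseWords cs).length ≤ e₀ →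
      (∀ t, t < (clauseWords cs).length → G (p + t) = (clauseWords cs).getD t 0) →
      (∀ c ∈ cs, ∀ l ∈ c, litWord l < 2 ^ w) → (∀ c ∈ cs, c.length < 2 ^ w) →
      e₀ + (ys ++ cs.flatMap C.clauseCodes).length < 2 ^ w →
      ∃ (R' : ℕ → ℕ) (t : ℕ), Exec w O (clauseLoop C) ⟨merge R (outMem G e₀ ys), qs⟩
          ⟨merge R' (outMem G e₀ (ys ++ cs.flatMap C.clauseCodes)), qs⟩ t ∧
        t ≤ clauseTime cs + 1 ∧ R' 20 = e₀ + (ys ++ cs.flatMap C.clauseCodes).length ∧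
        R' 21 = (ys ++ cs.flatMap C.clauseCodes).length
  | [], ys, R, p, h20, h21, h22, h23, hp, hpe, hG, hlw, hcl, hw => by
    refine ⟨R, 1, ?_, by simp [clauseTime], by simpa using h20, by simpa using h21⟩
    rw [List.flatMap_nil, List.append_nil]
    exact Exec.while_zero (by simp [Operand.read_dir_merge (show 23 < 100 by decide), h23])
  | c :: cs, ys, R, p, h20, h21, h22, h23, hp, hpe, hG, hlw, hcl, hw => by
    have hcw : clauseWords (c :: cs) = c.length :: c.map litWord ++ clauseWords cs :=
      clauseWords_cons c cs
    have hlenw : (clauseWords (c :: cs)).length = c.length + 1 + (clauseWords cs).length := by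
      rw [hcw]; simp; omega
    rw [hlenw] at hpe
    have hltot : (ys ++ (c :: cs).flatMap C.clauseCodes).length =
        ys.length + ((c.flatMap C.litCodes).length + 2) + (cs.flatMap C.clauseCodes).length := by
      simp [Codes.clauseCodes]; omega
    rw [hltot] at hw
    have hc0 : G p = c.length := by
      have := hG 0 (by rw [hlenw]; omega)
      rw [hcw] at this
      simpa using this
    -- 1. the opening bracket
    have h1 := emitC_exec (O := O) (G := G) (c := C.bra) h20 h21 he
      (lt_of_le_of_lt C.bra_le_sup hC) (by omega) qs
    set R₁ : ℕ → ℕ := Function.update (Function.update R 20 (e₀ + ys.length + 1)) 21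
      (ys.length + 1) with hR₁
    -- 2. the clause length
    have hGp : outMem G e₀ (ys ++ [C.bra]) p = c.length := by
      rw [outMem_of_lt G _ (show p < e₀ by omega), hc0]
    have h2 := cntRead_exec (w := w) (O := O) (R := R₁) (Or.inr rfl) (by simp [hR₁, h22]) hp hGp
      (hcl c (by simp)) (by omega) qs
    set R₂ : ℕ → ℕ := Function.update (Function.update R₁ 24 c.length) 22 (p + 1) with hR₂
    -- 3. the literals
    obtain ⟨R₃, t3, h3, ht3, h20₃, h21₃, h22₃, h23₃⟩ := litLoop_exec C hC he qs c (ys ++ [C.bra]) R₂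
      (p + 1) (by simp [hR₂, hR₁]; omega) (by simp [hR₂, hR₁]) (by simp [hR₂]) (by simp [hR₂])
      (by omega) (by omega)
      (fun t ht => by
        have := hG (t + 1) (by rw [hlenw]; omega)
        rw [hcw, List.cons_append, List.getD_cons_succ,
          List.getD_append _ _ _ _ (by simpa using ht)] at this
        simpa [Nat.add_assoc, Nat.add_comm 1 t] using this)
      (hlw c (by simp)) (by simp at hw ⊢; omega)
    -- 4. the closing bracket
    have h4 := emitC_exec (O := O) (G := G) (c := C.ket) h20₃ h21₃ he
      (lt_of_le_of_lt C.ket_le_sup hC) (by simp at hw ⊢; omega) qs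
    -- 5. the counter
    have h23₄ : (Function.update (Function.update R₃ 20
        (e₀ + (ys ++ [C.bra] ++ c.flatMap C.litCodes).length + 1)) 21
        ((ys ++ [C.bra] ++ c.flatMap C.litCodes).length + 1)) 23 = cs.length + 1 := by
      simp [h23₃, hR₂, hR₁, h23]
    have h5 := dec_exec (w := w) (O := O)
      (H := outMem G e₀ (ys ++ [C.bra] ++ c.flatMap C.litCodes ++ [C.ket])) (Or.inl rfl) h23₄
      (by have := length_le_length_clauseWords cs; omega) qs
    have heq : ys ++ [C.bra] ++ c.flatMap C.litCodes ++ [C.ket] = ys ++ C.clauseCodes c := by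
      simp [Codes.clauseCodes]
    rw [heq] at h4 h5
    set R₄ : ℕ → ℕ := Function.update (Function.update (Function.update R₃ 20
      (e₀ + (ys ++ [C.bra] ++ c.flatMap C.litCodes).length + 1)) 21
      ((ys ++ [C.bra] ++ c.flatMap C.litCodes).length + 1)) 23 cs.length with hR₄
    have hlenc : (ys ++ C.clauseCodes c).length = (ys ++ [C.bra] ++ c.flatMap C.litCodes).length + 1 := by
      simp [Codes.clauseCodes]; omega
    -- 6. the remaining clauses
    obtain ⟨R', t', hrec, ht', h20', h21'⟩ := clauseLoop_exec C hC he qs cs (ys ++ C.clauseCodes c) R₄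
      (p + 1 + c.length) (by rw [hlenc]; simp [hR₄]; omega)
      (by rw [hlenc]; simp [hR₄]) (by simp [hR₄, h22₃]) (by simp [hR₄]) (by omega) (by omega)
      (fun t ht => by
        have := hG (c.length + 1 + t) (by rw [hlenw]; omega)
        rw [hcw, List.cons_append, show c.length + 1 + t = (c.length + t) + 1 by omega,
          List.getD_cons_succ, List.getD_append_right _ _ _ _ (by simp)] at this
        simpa [Nat.add_assoc, Nat.add_comm, Nat.add_left_comm] using this)
      (fun c' hc' => hlw c' (by simp [hc'])) (fun c' hc' => hcl c' (by simp [hc']))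
      (by simp [Codes.clauseCodes] at hw ⊢; omega)
    rw [List.append_assoc] at hrec h20' h21'
    have hfl : C.clauseCodes c ++ cs.flatMap C.clauseCodes = (c :: cs).flatMap C.clauseCodes := by
      simp
    rw [hfl] at hrec h20' h21'
    refine ⟨R', (3 + (2 + (t3 + (3 + 1)))) + t' + 2,
      Exec.while_ne ?_ (h1.seq (h2.seq (h3.seq (h4.seq h5)))) hrec, ?_, h20', h21'⟩
    · simp [Operand.read_dir_merge (show 23 < 100 by decide), h23]
    · simp only [clauseTime]; omega

/-- The six header instructions of the transcoder. [folklore] -/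
theorem header_exec {R H : ℕ → ℕ} {D n : ℕ} (h1 : R 1 = D) (hD : 100 ≤ D) (hn : H (D + 1) = n)
    (hnw : n < 2 ^ w) (hDw : 2 * D < 2 ^ w) (qs : List (List ℕ)) :
    Exec w O (block [(.add, .dir 20, .dir 1, .dir 1), (.sub, .dir 20, .dir 20, .imm 99),
      (.add, .dir 21, .imm 0, .imm 0), (.add, .dir 22, .dir 1, .imm 1), (.add, .dir 25, .ind 22, .imm 0),
      (.add, .dir 22, .dir 22, .imm 1)]) ⟨merge R H, qs⟩
      ⟨merge (Function.update (Function.update (Function.update (Function.update (Function.update R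
        20 (2 * D - 99)) 21 0) 22 (D + 1)) 25 n) 22 (D + 2)) H, qs⟩ 6 := by
  have key : ∀ Rf, execOps w (merge R H) [(.add, .dir 20, .dir 1, .dir 1),
      (.sub, .dir 20, .dir 20, .imm 99), (.add, .dir 21, .imm 0, .imm 0), (.add, .dir 22, .dir 1, .imm 1),
      (.add, .dir 25, .ind 22, .imm 0), (.add, .dir 22, .dir 22, .imm 1)] = Rf →
      Rf = merge (Function.update (Function.update (Function.update (Function.update
        (Function.update R 20 (2 * D - 99)) 21 0) 22 (D + 1)) 25 n) 22 (D + 2)) H := by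
    intro Rf hR
    have htmp := execOps_cons_fwd hR; clear hR; obtain ⟨v1, hv1, hR⟩ := htmp
    simp -failIfUnchanged (disch := omega) only [Operand.write, Operand.read, merge_apply_of_lt,
      update_merge_of_lt,
      BinOp.eval_add_of_lt, h1] at hv1 hR
    have htmp := execOps_cons_fwd hR; clear hR; obtain ⟨v2, hv2, hR⟩ := htmp
    simp -failIfUnchanged (disch := omega) only [Operand.write, Operand.read, merge_apply_of_lt,
      Function.update_self, update_merge_of_lt,
      BinOp.eval_sub_of_le, ← hv1] at hv2 hR
    have htmp := execOps_cons_fwd hR; clear hR; obtain ⟨v3, hv3, hR⟩ := htmp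
    simp -failIfUnchanged (disch := omega) only [Operand.write, Operand.read,
      update_merge_of_lt,
      Nat.add_zero, BinOp.eval_add_of_lt, ← hv2] at hv3 hR
    have htmp := execOps_cons_fwd hR; clear hR; obtain ⟨v4, hv4, hR⟩ := htmp
    simp -failIfUnchanged (disch := omega) only [Operand.write, Operand.read, merge_apply_of_lt,
      Function.update_of_ne, update_merge_of_lt,
      BinOp.eval_add_of_lt, h1, ← hv3] at hv4 hR
    have htmp := execOps_cons_fwd hR; clear hR; obtain ⟨v5, hv5, hR⟩ := htmp
    simp -failIfUnchanged (disch := omega) only [Operand.write, Operand.read, merge_apply_of_lt,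
      merge_apply_of_le, Function.update_self, update_merge_of_lt,
      Nat.add_zero, BinOp.eval_add_of_lt, hn, ← hv4] at hv5 hR
    have htmp := execOps_cons_fwd hR; clear hR; obtain ⟨v6, hv6, hR⟩ := htmp
    simp -failIfUnchanged (disch := omega) only [Operand.write, Operand.read, merge_apply_of_lt,
      Function.update_self, Function.update_of_ne, update_merge_of_lt,
      BinOp.eval_add_of_lt, ← hv5] at hv6 hR
    simp only [execOps_nil] at hR; subst hR
    subst hv1 hv2 hv3 hv4 hv5 hv6
    rw [Function.update_idem, show D + D = 2 * D by ring]
  exact Exec.block' _ qs (key _ rfl)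

/-- The entries of `encodeCNFWords`. [folklore] -/
theorem mem_encodeCNFWords (φ : CNF ℕ) :
    φ.numVars ∈ encodeCNFWords φ ∧ φ.numClauses ∈ encodeCNFWords φ ∧
      (∀ c ∈ φ, c.length ∈ encodeCNFWords φ) ∧ ∀ c ∈ φ, ∀ l ∈ c, litWord l ∈ encodeCNFWords φ := by
  rw [encodeCNFWords_eq]
  refine ⟨by simp, by simp, fun c hc => ?_, fun c hc l hl => ?_⟩
  · simp only [List.mem_cons, clauseWords, List.mem_flatMap]
    exact Or.inr (Or.inr ⟨c, hc, by simp⟩)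
  · simp only [List.mem_cons, clauseWords, List.mem_flatMap]
    refine Or.inr (Or.inr ⟨c, hc, ?_⟩)
    simp only [List.mem_map]
    exact Or.inr ⟨l, hl, rfl⟩

/-- The length of `encodeCNFWords`. [folklore] -/
theorem length_encodeCNFWords (φ : CNF ℕ) :
    (encodeCNFWords φ).length = (clauseWords φ).length + 2 := by
  rw [encodeCNFWords_eq]; simp

/-- `cnfCodes` as header plus clause codes. [folklore] -/
theorem cnfCodes_eq (C : Codes) (φ : CNF ℕ) :
    C.cnfCodes φ = C.bitsCode φ.numVars ++ [C.comma] ++ φ.flatMap C.clauseCodes := by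
  simp [Codes.cnfCodes]

/-- **Semantics of the transcoder.** Started on the relocated memory of the `CNFSAT` input
`encodeCNFWords φ` of length `L` (all words, `2 L + 200` and the end of the output below `2 ^ w`),
`transcode C` writes the code list `cnfCodes C φ` from address `2 L + 101` on, within
`transcodeTime φ` steps, and leaves the end address and the length of the output in registers
`20`, `21`. [folklore] -/
theorem transcode_exec (C : Codes) (hC : C.sup < 2 ^ w) (φ : CNF ℕ)
    (hx : ∀ v ∈ encodeCNFWords φ, v < 2 ^ w)
    (hw : 2 * (encodeCNFWords φ).length + 101 + (C.cnfCodes φ).length < 2 ^ w)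
    (hL : 2 * (encodeCNFWords φ).length + 200 < 2 ^ w) (qs : List (List ℕ)) :
    ∃ (R' : ℕ → ℕ) (t : ℕ), Exec w O (transcode C) ⟨relocated (encodeCNFWords φ), qs⟩
        ⟨merge R' (outMem (relocated (encodeCNFWords φ)) (2 * (encodeCNFWords φ).length + 101)
          (C.cnfCodes φ)), qs⟩ t ∧
      t ≤ transcodeTime φ ∧
      R' 20 = 2 * (encodeCNFWords φ).length + 101 + (C.cnfCodes φ).length ∧
      R' 21 = (C.cnfCodes φ).length := by
  set x := encodeCNFWords φ with hxdef
  obtain ⟨hmn, hmm, hmc, hml⟩ := mem_encodeCNFWords φ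
  rw [← hxdef] at hmn hmm hmc hml
  have hLx : x.length = (clauseWords φ).length + 2 := length_encodeCNFWords φ
  set L := x.length with hLdef
  set D := L + 100 with hDdef
  set e₀ := 2 * L + 101 with he₀
  have hGx : ∀ i, 1 ≤ i → i ≤ L → relocated x (D + i) = x.getD (i - 1) 0 := fun i h1 h2 =>
    relocated_base_add x h1 h2
  -- 1. header
  have hD1 : relocated x (D + 1) = φ.numVars := by
    rw [hGx 1 le_rfl (by omega), hxdef, encodeCNFWords_eq]; rfl
  have h1 := header_exec (w := w) (O := O) (R := relocated x) (H := relocated x) (relocated_one x)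
    (by omega) hD1 (hx _ hmn) (by omega) qs
  rw [merge_self] at h1
  set R₁ : ℕ → ℕ := Function.update (Function.update (Function.update (Function.update
    (Function.update (relocated x) 20 (2 * D - 99)) 21 0) 22 (D + 1)) 25 φ.numVars) 22 (D + 2)
    with hR₁
  -- 2. the digits of numVars
  have hcnf := cnfCodes_eq C φ
  have hlen : (C.cnfCodes φ).length =
      (C.bitsCode φ.numVars).length + 1 + (φ.flatMap C.clauseCodes).length := by
    rw [hcnf]; simp only [List.length_append, List.length_singleton]
  obtain ⟨R₂, t2, h2, ht2, h20₂, h21₂, -, hR₂⟩ := emitBits_exec C hC (G := relocated x) (e₀ := e₀)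
    (by omega) qs _ φ.numVars rfl (hx _ hmn) [] R₁ (by simp [hR₁]; omega) (by simp [hR₁])
    (by simp [hR₁]) (by simp; omega)
  rw [outMem_nil] at h2
  simp only [List.nil_append] at h2 h20₂ h21₂
  -- 3. the comma
  have h3 := emitC_exec (O := O) (G := relocated x) (c := C.comma) h20₂ h21₂ (by omega)
    (lt_of_le_of_lt C.comma_le_sup hC) (by omega) qs
  set R₃ : ℕ → ℕ := Function.update (Function.update R₂ 20 (e₀ + (C.bitsCode φ.numVars).length + 1))
    21 ((C.bitsCode φ.numVars).length + 1) with hR₃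
  -- 4. numClauses
  have hD2 : outMem (relocated x) e₀ (C.bitsCode φ.numVars ++ [C.comma]) (D + 2) = φ.numClauses := by
    rw [outMem_of_lt _ _ (by omega), hGx 2 (by omega) (by omega), hxdef, encodeCNFWords_eq]; rfl
  have h4 := cntRead_exec (w := w) (O := O) (R := R₃) (Or.inl rfl)
    (by simp [hR₃, hR₂ 22 (by decide) (by decide) (by decide) (by decide), hR₁]) (by omega) hD2
    (hx _ hmm) (by omega) qs
  set R₄ : ℕ → ℕ := Function.update (Function.update R₃ 23 φ.numClauses) 22 (D + 2 + 1) with hR₄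
  -- 5. the clauses
  obtain ⟨R', t5, h5, ht5, h20', h21'⟩ := clauseLoop_exec C hC (G := relocated x) (e₀ := e₀) (by omega)
    qs φ (C.bitsCode φ.numVars ++ [C.comma]) R₄ (D + 3) (by simp [hR₄, hR₃]; omega)
    (by simp [hR₄, hR₃]) (by simp [hR₄]) (by simp [hR₄]; rfl) (by omega) (by omega)
    (fun t ht => by
      rw [show D + 3 + t = D + (3 + t) by omega, hGx (3 + t) (by omega) (by omega), hxdef,
        encodeCNFWords_eq, show 3 + t - 1 = t + 2 by omega]
      rfl)
    (fun c hc l hl => hx _ (hml c hc l hl)) (fun c hc => hx _ (hmc c hc))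
    (by rw [hlen] at hw; simp only [List.length_append, List.length_singleton]; omega)
  rw [← hcnf] at h5 h20' h21'
  refine ⟨R', 6 + (t2 + (3 + (2 + t5))), h1.seq (h2.seq (h3.seq (h4.seq h5))), ?_, ?_, h21'⟩
  · unfold transcodeTime; omega
  · rw [h20']

end exec

end Literature.Computability.FineGrained.KSatTranscoder
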